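import Summits.HodgeConjecture.HodgeConjecture.Theorems.MilnorKExponentialDefs
import Literature.AlgebraicGeometry.HodgeTheory.HodgeFiltration
import Literature.AlgebraicGeometry.HodgeTheory.ComplexConjugationHolds
import Literature.AlgebraicGeometry.HodgeTheory.HodgeFiltrationModelsReductionProofs
import Literature.AlgebraicGeometry.Motives.Varieties
import Literature.AlgebraicGeometry.Motives.GAGAKaehlerImmersionProofs
import Literature.AlgebraicGeometry.HodgeTheory.HodgeModelExistenceProofs
import Summits.HodgeConjecture.HodgeConjecture.Theorems.MilnorKExponentialSymbolClassesAlgebraicSymbolClassesHodgeTypeZigzag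

/-!
# Stub (T) `stub_symbolClassesHodgeType : HodgeTypeNamed` — rational symbol classes are of Hodge type `(q+1, q+1)`

Stub proof for the line `NashDescentSketch` of the crux `SymbolClassesAlgebraic`
(stmt-HodgeConjecture-17743; the statement `HodgeTypeNamed` is the route's support item
`SymbolClassesHodgeType`, stmt-HodgeConjecture-17746, in named form, from
`Theorems/MilnorKExponentialDefs`). Everything below is proved; no named fact is introduced.

Structure of the proof.

1. (analytic part, `transgression_mk_mem_iSup_hodgePQ`, with helpers 1–3) on a Hodge model `A` of a
   smooth projective `X`, the de Rham class of a Čech–de Rham transgression `θ` of the symbol forms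
   of a Milnor symbol cocycle of weight `q + 1` lies in `F^{q+1} H^{2q+2}_dR(X^an)`;
2. hence `A^* c ∈ F^{q+1}` (`A.deRham [θ] = m • A^* c`, `m ≠ 0`), hence — Hodge filtrations do not
   depend on the model, `hodgePQ_independent_of_hodgeModel_holds` — the same in a REAL Hodge model
   `A'` (`exists_isReal_hodgeModel_holds`);
3. `c` rational ⇒ `A'^* c` is fixed by complex conjugation; in a real model conjugation swaps
   `H^{P,Q}` and `H^{Q,P}`, and the pieces form a direct sum (field `isInternal_hodgePQ`), so a real
   class of `F^p H^{2p}` lies in `H^{p,p}`.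
-/

noncomputable section

open scoped Manifold Topology ContDiff
open CategoryTheory AlgebraicGeometry Filter

-- the tree's own summit-side namespaces repeat `HodgeConjecture` (summit = sub-problem)
set_option linter.dupNamespace false

-- `TangentSpace 𝓘(ℝ, E) x = E` is an abuse of definitional equality; let `isDefEq` unfold it.
set_option backward.isDefEq.respectTransparency false

namespace Summit.HodgeConjecture.HodgeConjecture.Theorems.MilnorKExponentialNash

open Literature.AlgebraicGeometry Literature.AlgebraicGeometry.HodgeTheory
  Literature.AlgebraicGeometry.Motives Literature.Geometry.Kaehler
  Literature.NumberTheory.Transcendental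

/-! ### Step 3: a real class of `F^p H^{2p}` lies in `H^{p,p}` (direct sum + Hodge symmetry) -/

section RealClasses

variable {E : Type*} [NormedAddCommGroup E] [NormedSpace ℂ E]
  {M : Type*} [TopologicalSpace M] [ChartedSpace E M]

/-- In an internal direct sum `V = ⨁ T i`, an element of `⨆_{i ∈ S} T i` has zero components off
`S`. [folklore] -/
theorem directSum_component_eq_zero_of_mem_biSup {R V : Type*} [CommRing R] [AddCommGroup V]
    [Module R V] {ι : Type*} [DecidableEq ι] {T : ι → Submodule R V}
    (h : DirectSum.IsInternal T) (S : ι → Prop) {x : V} (hx : x ∈ ⨆ (i) (_ : S i), T i)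
    {j : ι} (hj : ¬ S j) :
    (LinearEquiv.ofBijective (DirectSum.coeLinearMap T) h).symm x j = 0 := by
  induction hx using Submodule.iSup_induction' with
  | mem i x hxi =>
    by_cases hSi : S i
    · rw [iSup_pos hSi] at hxi
      have hij : i ≠ j := fun hij ↦ hj (hij ▸ hSi)
      exact h.ofBijective_coeLinearMap_of_mem_ne hij hxi
    · rw [iSup_neg hSi, Submodule.mem_bot] at hxi
      rw [hxi, map_zero]
      rfl
  | zero => rw [map_zero]; rfl
  | add x y _ _ hx hy => rw [map_add, DirectSum.add_apply, hx, hy, add_zero]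

/-- In an internal direct sum `V = ⨁ T i` over a finite index type, an element all of whose
components but the `j`-th vanish lies in `T j`. [folklore] -/
theorem mem_of_directSum_component_eq_zero {R V : Type*} [CommRing R] [AddCommGroup V]
    [Module R V] {ι : Type*} [DecidableEq ι] [Fintype ι] {T : ι → Submodule R V}
    (h : DirectSum.IsInternal T) {x : V} (j : ι)
    (hx : ∀ i, i ≠ j → (LinearEquiv.ofBijective (DirectSum.coeLinearMap T) h).symm x i = 0) :
    x ∈ T j := by
  set e := LinearEquiv.ofBijective (DirectSum.coeLinearMap T) h with he
  have hxe : x = DirectSum.coeLinearMap T (e.symm x) := (e.apply_symm_apply x).symm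
  rw [← DirectSum.sum_univ_of (e.symm x), map_sum] at hxe
  rw [hxe]
  refine Submodule.sum_mem _ fun i _ ↦ ?_
  rw [DirectSum.coeLinearMap_of]
  by_cases hij : i = j
  · subst hij
    exact (e.symm x i).2
  · rw [hx i hij]
    exact Submodule.zero_mem _

/-- **A conjugation-invariant de Rham class of `F^p H^{2p}` lies in `H^{p,p}`** on a manifold whose
pieces `H^{P,Q}`, `P + Q = k`, form a direct sum: conjugation maps `H^{P,Q}` onto `H^{Q,P}`
(`Motives.conj_hodgePQ_eq`), so the class lies in `(⨆_{P ≥ p} H^{P,Q}) ⊓ (⨆_{Q ≥ p} H^{P,Q}) = H^{p,p}`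
(`k = p + p`). [cite: VoisinHodgeI2002, Cor. 6.12 and §7.1.1] -/
theorem mem_hodgePQ_of_mem_iSup_of_conj_eq {k p : ℕ} (hk : p + p = k)
    (hint : DirectSum.IsInternal fun pq : ↥(Finset.HasAntidiagonal.antidiagonal k) ↦
      hodgePQ E M k pq.1.1 pq.1.2)
    {η : complexDeRhamCohomology E M k}
    (hη : η ∈ ⨆ (P : ℕ) (Q : ℕ) (_ : P + Q = k) (_ : p ≤ P), hodgePQ E M k P Q)
    (hconj : complexDeRhamCohomology.conj E M k conj_mem_cclosedSmoothForms_holds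
      conj_mem_cexactSmoothForms_holds η = η) :
    η ∈ hodgePQ E M k p p := by
  classical
  let T : ↥(Finset.HasAntidiagonal.antidiagonal k) → Submodule ℂ (complexDeRhamCohomology E M k) :=
    fun pq ↦ hodgePQ E M k pq.1.1 pq.1.2
  let F₁ : Submodule ℂ (complexDeRhamCohomology E M k) :=
    ⨆ (pq : ↥(Finset.HasAntidiagonal.antidiagonal k)) (_ : p ≤ pq.1.1), T pq
  let F₂ : Submodule ℂ (complexDeRhamCohomology E M k) :=
    ⨆ (pq : ↥(Finset.HasAntidiagonal.antidiagonal k)) (_ : p ≤ pq.1.2), T pq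
  have hT₁ : ∀ P Q : ℕ, ∀ hPQ : P + Q = k, p ≤ P → hodgePQ E M k P Q ≤ F₁ := by
    intro P Q hPQ hpP y hy
    have hy' : y ∈ T ⟨(P, Q), Finset.HasAntidiagonal.mem_antidiagonal.2 hPQ⟩ := hy
    exact Submodule.mem_iSup_of_mem _ (Submodule.mem_iSup_of_mem hpP hy')
  have hT₂ : ∀ P Q : ℕ, ∀ hPQ : P + Q = k, p ≤ Q → hodgePQ E M k P Q ≤ F₂ := by
    intro P Q hPQ hpQ y hy
    have hy' : y ∈ T ⟨(P, Q), Finset.HasAntidiagonal.mem_antidiagonal.2 hPQ⟩ := hy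
    exact Submodule.mem_iSup_of_mem _ (Submodule.mem_iSup_of_mem hpQ hy')
  -- `η ∈ F₁`
  have h1 : η ∈ F₁ := by
    have hle : (⨆ (P : ℕ) (Q : ℕ) (_ : P + Q = k) (_ : p ≤ P), hodgePQ E M k P Q) ≤ F₁ :=
      iSup_le fun P ↦ iSup_le fun Q ↦ iSup_le fun hPQ ↦ iSup_le fun hpP ↦ hT₁ P Q hPQ hpP
    exact hle hη
  -- `η = conj η ∈ F₂`
  have h2 : η ∈ F₂ := by
    rw [← hconj]
    have hmap : (⨆ (P : ℕ) (Q : ℕ) (_ : P + Q = k) (_ : p ≤ P), hodgePQ E M k P Q).map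
        (complexDeRhamCohomology.conj E M k conj_mem_cclosedSmoothForms_holds
          conj_mem_cexactSmoothForms_holds) ≤ F₂ := by
      simp only [Submodule.map_iSup]
      refine iSup_le fun P ↦ iSup_le fun Q ↦ iSup_le fun hPQ ↦ iSup_le fun hpP ↦ ?_
      rw [Motives.conj_hodgePQ_eq]
      exact hT₂ Q P (by omega) hpP
    exact hmap (Submodule.mem_map_of_mem hη)
  -- components off `(p, p)` vanish
  let j₀ : ↥(Finset.HasAntidiagonal.antidiagonal k) :=
    ⟨(p, p), Finset.HasAntidiagonal.mem_antidiagonal.2 hk⟩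
  have hcomp : ∀ i : ↥(Finset.HasAntidiagonal.antidiagonal k), i ≠ j₀ →
      (LinearEquiv.ofBijective (DirectSum.coeLinearMap T) hint).symm η i = 0 := by
    intro i hi
    have hik : i.1.1 + i.1.2 = k := Finset.HasAntidiagonal.mem_antidiagonal.1 i.2
    by_cases hP : p ≤ i.1.1
    · have hQ : ¬ p ≤ i.1.2 := by
        intro hQ
        apply hi
        have h₁ : i.1.1 = p := by omega
        have h₂ : i.1.2 = p := by omega
        exact Subtype.ext (Prod.ext h₁ h₂)
      exact directSum_component_eq_zero_of_mem_biSup hint (fun pq ↦ p ≤ pq.1.2) h2 hQ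
    · exact directSum_component_eq_zero_of_mem_biSup hint (fun pq ↦ p ≤ pq.1.1) h1 hP
  exact mem_of_directSum_component_eq_zero hint j₀ hcomp

end RealClasses

variable {n : ℕ} {X : SchemeOver ℂ}

/-- **In a REAL Hodge model, a conjugation-invariant class of `F^p H^{2p}(X^an; ℂ)` lies in
`H^{p,p}`**: transport through the comparison `A.deRham` (which intertwines the conjugations,
`HodgeModel.IsReal`) of `mem_hodgePQ_of_mem_iSup_of_conj_eq`, the direct sum being the field
`isInternal_hodgePQ` of the model. [cite: VoisinHodgeI2002, Cor. 6.12 and §7.1.1] -/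
theorem mem_hodgePQ_of_mem_hodgeFiltration_of_conjClass_eq (A : HodgeModel n X)
    (hA : A.IsReal) {k p : ℕ} (hk : p + p = k)
    {x : Literature.AlgebraicTopology.SingularHomology.singularCohomology ℂ ℂ A.carrier k}
    (hx : x ∈ A.hodgeFiltration k p) (hreal : conjClass A.carrier k x = x) :
    x ∈ A.hodgePQ k p p := by
  obtain ⟨η, rfl⟩ : ∃ η, A.deRham A.carrier k η = x := (A.deRham A.carrier k).surjective x
  -- `η ∈ F^p` on the de Rham side
  have hη : η ∈ ⨆ (P : ℕ) (Q : ℕ) (_ : P + Q = k) (_ : p ≤ P), hodgePQ A.model A.carrier k P Q := by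
    have hF : A.hodgeFiltration k p =
        (⨆ (P : ℕ) (Q : ℕ) (_ : P + Q = k) (_ : p ≤ P), hodgePQ A.model A.carrier k P Q).map
          (A.deRham A.carrier k).toLinearMap := by
      simp only [HodgeModel.hodgeFiltration, HodgeModel.hodgePQ, Submodule.map_iSup]
    rw [hF, Submodule.mem_map] at hx
    obtain ⟨η', hη', hηη'⟩ := hx
    obtain rfl : η' = η := (A.deRham A.carrier k).injective hηη'
    exact hη'
  -- `conj η = η`
  have hconj : complexDeRhamCohomology.conj A.model A.carrier k conj_mem_cclosedSmoothForms_holds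
      conj_mem_cexactSmoothForms_holds η = η := by
    apply (A.deRham A.carrier k).injective
    rw [← hA k η]
    exact hreal
  exact Submodule.mem_map_of_mem (f := (A.deRham A.carrier k).toLinearMap)
    (mem_hodgePQ_of_mem_iSup_of_conj_eq hk (A.isInternal_hodgePQ k) hη hconj)

/-! ### Step 1 (analytic input): transgressions of holomorphic symbol cocycles lie in `F^{q+1}` -/

/-- The carrier of a Hodge model of a smooth projective variety is compact (`X(ℂ)` is compact and
the comparison map is a homeomorphism). [cite: SerreGAGA1956, §2 n°7 Prop. 6] -/
theorem compactSpace_carrier' (A : HodgeModel n X) (hX : IsSmoothProjective n X) :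
    CompactSpace A.carrier :=
  haveI := compactSpace_complexPoints_of_isSmoothProjective hX
  A.isAnalytification.homeomorph.symm.compactSpace

/-- Hodge models of smooth projective varieties are Kähler (Fubini–Study pulled back along a
projective embedding, `Motives.isKaehlerManifold_of_isAnalytification_of_isClosedImmersion_holds`).
[cite: VoisinHodgeI2002, §3.3.2] -/
theorem isKaehlerManifold_carrier' (A : HodgeModel n X) (hX : IsSmoothProjective n X) :
    IsKaehlerManifold A.model A.carrier := by
  haveI : AlgebraicGeometry.SmoothOfRelativeDimension n X.hom := hX.smoothOfRelativeDimension
  obtain ⟨N, ιN, hιN⟩ := hX.isProjectiveOver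
  exact Motives.isKaehlerManifold_of_isAnalytification_of_isClosedImmersion_holds (X := X) (d := n)
    (E := A.model) (M := A.carrier) (φ := A.toComplexPoints) ιN A.isAnalytification

/-- **The analytic input of stub (T)**: on a Hodge model `A` of a smooth projective `X`, the de Rham
class of a Čech–de Rham transgression `θ` (Bott–Tu zig-zag, `IsTransgression`) of the symbol forms
`Σ n · dlog f₁ ∧ ⋯ ∧ dlog f_{q+1}` of a Milnor symbol cocycle of a finite open cover lies in the
Hodge filtration step `F^{q+1} H^{2q+2}_dR(X^an; ℂ) = ⨆_{P ≥ q+1, P+Q = 2q+2} H^{P,Q}`: the symbol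
forms are of type `(q+1, 0)` on the `U_J` (`typeComponent_symbolForm_apply_eq_zero`), so there is
a transgression `θ'` of the same cochain staying in `F^{q+1}`
(`exists_isTransgression_typeComponent_eq_zero`), `θ - θ'` is exact
(`exists_sub_eq_mextDeriv_of_isTransgression`), and on the compact Kähler manifold `X^an` the class
of the closed form `θ' ∈ F^{q+1} A^{2q+2}` lies in `F^{q+1} H^{2q+2}`
(`mk_mem_iSup_hodgePQ_of_typeComponent_eq_zero`, the `∂∂̄`-lemma).
[cite: VoisinHodgeI2002, Prop. 6.17 and Prop. 7.5] [cite: BottTu1982Forms, §8 Prop. 8.8] -/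
theorem transgression_mk_mem_iSup_hodgePQ (hX : IsSmoothProjective n X) (A : HodgeModel n X) (q : ℕ)
    (ι : Type) [Fintype ι] (U : ι → Set A.carrier) (hU : ∀ i, IsOpen (U i))
    (hcov : ∀ x, ∃ i, x ∈ U i) (σ : (Fin (q + 2) → ι) → ((Fin (q + 1) → (A.carrier → ℂ)) →₀ ℤ))
    (hσ : IsMilnorSymbolCocycle A.model U σ)
    (θ : cclosedSmoothForms A.model A.carrier (2 * q + 1 + 1))
    (hT : IsTransgression hU q (fun J ↦ symbolForm A.model (q + 1) (σ J)) θ) :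
    complexDeRhamCohomology.mk A.model A.carrier (2 * q + 1 + 1) θ ∈
      ⨆ (P : ℕ) (Q : ℕ) (_ : P + Q = 2 * q + 1 + 1) (_ : q + 1 ≤ P),
        hodgePQ A.model A.carrier (2 * q + 1 + 1) P Q := by
  haveI : IsKaehlerManifold A.model A.carrier := isKaehlerManifold_carrier' A hX
  haveI : CompactSpace A.carrier := compactSpace_carrier' A hX
  -- the symbol forms are of type `(q+1, 0)` on the `U_J`
  have hw : ∀ J x, x ∈ cechSet U J → ∀ P Q : ℕ, P < q + 1 →
      (symbolForm A.model (q + 1) (σ J)).typeComponent P Q x = 0 :=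
    fun J x hx P Q hP ↦ typeComponent_symbolForm_apply_eq_zero (isOpen_cechSet hU J) (hσ.1 J) hx hP
  -- a transgression `θ'` of the same cochain staying in `F^{q+1}`
  obtain ⟨θ', hT', hθ's, hθ'F⟩ := exists_isTransgression_typeComponent_eq_zero hU hcov hT hw
  -- `θ - θ'` is exact, so `[θ] = [θ']`
  obtain ⟨η, hηs, hη⟩ := exists_sub_eq_mextDeriv_of_isTransgression hT hT' hcov
  have hθ'c : θ' ∈ cclosedSmoothForms A.model A.carrier (2 * q + 1 + 1) :=
    mem_cclosedSmoothForms hθ's (hT'.isClosedForm hcov)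
  have hcl : complexDeRhamCohomology.mk A.model A.carrier (2 * q + 1 + 1) θ =
      complexDeRhamCohomology.mk A.model A.carrier (2 * q + 1 + 1) ⟨θ', hθ'c⟩ := by
    rw [complexDeRhamCohomology.mk_eq_mk_iff]
    change (θ : MForm 𝓘(ℝ, A.model) A.carrier ℂ (2 * q + 1 + 1)) - θ' ∈
      cexactSmoothForms A.model A.carrier (2 * q + 1 + 1)
    rw [hη]
    exact Submodule.subset_span ⟨η, (mem_csmoothForms_iff η).2 hηs, rfl⟩
  rw [hcl]
  exact mk_mem_iSup_hodgePQ_of_typeComponent_eq_zero (q + 1) hθ'c hθ'F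

/-! ### Steps 2–3: the reduction -/

/-- **Stub (T) of the line `NashDescentSketch`** (= the route's support item
`SymbolClassesHodgeType` in named form): on a smooth projective complex variety, every RATIONAL
symbol class of weight `q + 1` — a class a non-zero integer multiple of whose pull-back to a Hodge
model is the de Rham class of a Čech–de Rham transgression of the `dlog`-forms of a Milnor symbol
cocycle — is of Hodge type `(q+1, q+1)`. Proof: the transgression lies in `F^{q+1} H^{2q+2}`
(`transgression_mk_mem_iSup_hodgePQ`), hence so does `A^* c`; Hodge filtrations do not depend on
the model (`hodgePQ_independent_of_hodgeModel_holds`), so the same holds in a REAL Hodge model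
(`exists_isReal_hodgeModel_holds`), where the rational, hence conjugation-invariant, class of
`F^{q+1} H^{2q+2}` lies in `H^{q+1,q+1}` (Hodge symmetry and the Hodge decomposition).
[cite: VoisinHodgeI2002, Cor. 6.12, Prop. 7.5 and §7.1.1] -/
theorem stub_symbolClassesHodgeType : HodgeTypeNamed := by
  intro n X hX q c hc hs
  obtain ⟨A, -, ι, hι, U, hU, hcov, σ, hσ, θ, m, hm, hT, hdR⟩ := hs
  -- Step 1: `A^* c ∈ F^{q+1}` on the symbol model `A`
  have h1 : A.pullback (2 * q + 1 + 1) c ∈ A.hodgeFiltration (2 * q + 1 + 1) (q + 1) := by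
    have hθ := transgression_mk_mem_iSup_hodgePQ hX A q ι U hU hcov σ hσ θ hT
    have hθ' : A.deRham A.carrier (2 * q + 1 + 1)
        (complexDeRhamCohomology.mk A.model A.carrier (2 * q + 1 + 1) θ) ∈
          A.hodgeFiltration (2 * q + 1 + 1) (q + 1) := by
      have hF' : A.hodgeFiltration (2 * q + 1 + 1) (q + 1) =
          (⨆ (P : ℕ) (Q : ℕ) (_ : P + Q = 2 * q + 1 + 1) (_ : q + 1 ≤ P),
            hodgePQ A.model A.carrier (2 * q + 1 + 1) P Q).map
            (A.deRham A.carrier (2 * q + 1 + 1)).toLinearMap := by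
        simp only [HodgeModel.hodgeFiltration, HodgeModel.hodgePQ, Submodule.map_iSup]
      rw [hF']
      exact Submodule.mem_map_of_mem hθ
    rw [hdR] at hθ'
    have hm' : (m : ℂ) ≠ 0 := Int.cast_ne_zero.2 hm
    have := Submodule.smul_mem _ (m : ℂ)⁻¹ hθ'
    rwa [smul_smul, inv_mul_cancel₀ hm', one_smul] at this
  -- Step 2: the same in a real Hodge model `A'`
  obtain ⟨A', hA'⟩ := exists_isReal_hodgeModel_holds n X hX
  have h2 : A'.pullback (2 * q + 1 + 1) c ∈ A'.hodgeFiltration (2 * q + 1 + 1) (q + 1) :=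
    hodgePQ_independent_of_hodgeModel.mem_hodgeFiltration hodgePQ_independent_of_hodgeModel_holds
      hX A A' h1
  -- Step 3: `A'^* c` is real, hence of type `(q+1, q+1)`
  have h3 : conjClass A'.carrier (2 * q + 1 + 1) (A'.pullback (2 * q + 1 + 1) c) =
      A'.pullback (2 * q + 1 + 1) c := by
    have hc' : conjClass (ComplexPoints X) (2 * q + 1 + 1) c = c := hc.conjClass_eq
    rw [HodgeModel.pullback, conjClass_map, hc']
  exact ⟨A', mem_hodgePQ_of_mem_hodgeFiltration_of_conjClass_eq A' hA' (by omega) h2 h3⟩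

end Summit.HodgeConjecture.HodgeConjecture.Theorems.MilnorKExponentialNash

end
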